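import Summits.KontsevichZagierPeriods.KontsevichZagierPeriods.Theorems.LinRedNormalFormHoffmanSpanInKZSpanTransfer
import Summits.KontsevichZagierPeriods.KontsevichZagierPeriods.Theorems.MzvKernelInKZ.Negative.WeightsTwoThree

/-!
# `HoffmanSpanInKZ` (stmt-KontsevichZagierPeriods-15044): negative side — load-bearing hypotheses and a refuted strengthening

Negative-side support for the crux `LinRedNormalForm.HoffmanSpanInKZ` (cdisprove unit, refuter seat
`refuter-cdisprove-stmt-KontsevichZagierPeriods-15044-0`; running commentary in the work file
`Cruxes/HoffmanSpanInKZ/Disproof.lean`).  The crux: every MZV word generator `[Δ_w, q·∏ ω_ε]` is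
congruent modulo `KZ.relations` to a `ℤ`-combination of Hoffman generators `[Δ_w, q'·ω_u]`,
`u ∈ {2,3}^×`, `|u| = w` (Kontsevich–Zagier 2001, §1.2 rules; Brown 2012, Thm 1.1 at the value
level).  Nothing here refutes it.  This file records, as theorems the other seats can import:

* §0 small models of the Hoffman generator set `hoffmanGens w` of the landed glue file: it is EMPTY
  in weight `1` (`hoffmanGens_one`, so the weight-`1` slice of the crux reads
  `[Δ₁, q ω_ε] ∈ KZ.relations`), and `(2,2)` is the only Hoffman index of weight `4`;
* §1 LOAD-BEARING ANALYSIS: `not_withoutDomain` (drop `s.domain = Δ_w`: false, witness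
  `[(1,2), dt/t]`, value `> 0`) and `not_withoutIntegrand` (drop the word shape of the integrand:
  false, witness `[Δ₁, 1]`, value `vol Δ₁ > 0`) — in weight `1` either variant would force a
  relation, hence value `0` by soundness (`KZ.relations_le_ker_eval_holds`);
* §2 the natural strengthening `SameCoefficient` (Hoffman generators with the SAME coefficient `q`,
  i.e. integer recombination only) is FALSE at weight `4`: `ζ(4) = π⁴/90 ∉ ℤ · π⁴/120 = ℤ · ζ(2,2)`
  (`Negative.value_ω4`, `Negative.value_ω22`); the crux's free rational `q'` is used.

Sources: M. Kontsevich, D. Zagier, *Periods* (2001), §§1.1–1.2; F. Brown, *Mixed Tate motives over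
ℤ*, Ann. of Math. 175 (2012), Thm 1.1; M. E. Hoffman, J. Algebra 194 (1997). -/

noncomputable section

namespace Summit.KontsevichZagierPeriods.HoffmanSpanInKZ.Negative

open Set MeasureTheory MvPolynomial
open Literature.NumberTheory.Transcendental
open Summit.KontsevichZagierPeriods.MzvKernelInKZ.Negative
open Summit.KontsevichZagierPeriods.MzvKernelInKZ.TwoPosets
open Summit.KontsevichZagierPeriods.LinRedNormalForm.HoffmanSpanInKZ (hoffmanGens)

/-! ## §0 Small models: the Hoffman generator sets in weights `0`, `1`, `4` -/

/-- No Hoffman index has weight `1` (entries are `2` or `3`). [folklore] -/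
theorem weight_ne_one_of_isHoffman {u : List ℕ} (hu : MZV.IsHoffman u) : MZV.weight u ≠ 1 := by
  cases u with
  | nil => simp [MZV.weight]
  | cons a l =>
    have ha := hu a (by simp)
    simp only [MZV.weight, List.sum_cons]
    omega

/-- The weight-`1` Hoffman generator set of the crux is empty. [folklore] -/
theorem hoffmanGens_one : hoffmanGens 1 = ∅ := by
  ext x
  simp only [hoffmanGens, mem_setOf_eq, mem_empty_iff_false, iff_false, not_exists, not_and]
  intro u q' s' hu hw
  exact absurd hw (weight_ne_one_of_isHoffman hu)

/-- Hence its closure is trivial: in weight `1` the crux asks `[Δ₁, q ω_ε] ∈ KZ.relations`. [folklore] -/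
theorem closure_hoffmanGens_one : AddSubgroup.closure (hoffmanGens 1) = ⊥ := by
  rw [hoffmanGens_one, AddSubgroup.closure_empty]

/-- The only Hoffman index of weight `4` is `(2,2)`. [folklore] -/
theorem eq_two_two_of_isHoffman {u : List ℕ} (hu : MZV.IsHoffman u) (hw : MZV.weight u = 4) :
    u = [2, 2] := by
  match u, hu, hw with
  | [], _, hw => simp [MZV.weight] at hw
  | [a], hu, hw =>
    have ha := hu a (by simp)
    simp [MZV.weight] at hw; omega
  | [a, b], hu, hw =>
    have ha := hu a (by simp)
    have hb := hu b (by simp)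
    simp only [MZV.weight, List.sum_cons, List.sum_nil] at hw
    have : a = 2 := by omega
    have : b = 2 := by omega
    subst_vars; rfl
  | a :: b :: c :: l, hu, hw =>
    have ha := hu a (by simp)
    have hb := hu b (by simp)
    have hc := hu c (by simp)
    simp only [MZV.weight, List.sum_cons] at hw
    omega

/-! ## §1 Load-bearing hypotheses -/

/-- The crux with the DOMAIN hypothesis `s.domain = Δ_w` dropped (integrand still of word shape on
whatever the domain is). Refuted below. -/
def WithoutDomain : Prop :=
  ∀ (w : ℕ) (ε : Fin w → Bool) (q : ℚ) (s : KZ.IntegralRep w),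
    EqOn s.integrand (fun t => (q : ℝ) * ∏ i, if ε i then 1 / (1 - t i) else 1 / t i) s.domain →
    ∃ m ∈ AddSubgroup.closure (hoffmanGens w), KZ.of s - m ∈ KZ.relations

/-- The crux with the INTEGRAND hypothesis dropped (any representation on the simplex).
Refuted below. -/
def WithoutIntegrand : Prop :=
  ∀ (w : ℕ) (s : KZ.IntegralRep w),
    s.domain = {t | (∀ i, 0 < t i) ∧ (∀ i, t i < 1) ∧ StrictAnti t} →
    ∃ m ∈ AddSubgroup.closure (hoffmanGens w), KZ.of s - m ∈ KZ.relations

/-- In weight `1` both variants force `[σ, f] ∈ KZ.relations`, hence value `0` (soundness). -/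
theorem value_eq_zero_of_weight_one (s : KZ.IntegralRep 1)
    (h : ∃ m ∈ AddSubgroup.closure (hoffmanGens 1), KZ.of s - m ∈ KZ.relations) :
    s.value = 0 := by
  obtain ⟨m, hm, hrel⟩ := h
  rw [closure_hoffmanGens_one, AddSubgroup.mem_bot] at hm
  subst hm
  rw [sub_zero] at hrel
  have := (AddMonoidHom.mem_ker).1 (KZ.relations_le_ker_eval_holds hrel)
  rwa [KZ.eval_of] at this

/-- The shifted interval `(1,2) ⊆ ℝ¹`. [folklore] -/
def shiftedInterval : Set (Fin 1 → ℝ) := {t | 1 < t 0 ∧ t 0 < 2}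

/-- `(1,2) ⊆ ℝ¹` is `ℚ`-semialgebraic (two strict polynomial inequalities). [folklore] -/
theorem isSemialgebraic_shiftedInterval :
    Literature.ModelTheory.ExponentialFields.IsSemialgebraic ℚ shiftedInterval := by
  have h : shiftedInterval = {t : Fin 1 → ℝ | 0 < aeval t (X 0 - 1 : MvPolynomial (Fin 1) ℚ)} ∩
      {t | 0 < aeval t (2 - X 0 : MvPolynomial (Fin 1) ℚ)} := by
    ext t; simp [shiftedInterval, sub_pos]
  rw [h]
  exact (Literature.ModelTheory.ExponentialFields.isSemialgebraic_setOf_eval_pos _).inter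
    (Literature.ModelTheory.ExponentialFields.isSemialgebraic_setOf_eval_pos _)

/-- `(1,2)` lies in the compact box `[1,2]`. [folklore] -/
theorem shiftedInterval_subset_Icc :
    shiftedInterval ⊆ Icc (fun _ => (1 : ℝ)) (fun _ => 2) := by
  intro t ht
  refine ⟨fun i => ?_, fun i => ?_⟩ <;> fin_cases i <;> simp [ht.1.le, ht.2.le]

/-- `(1,2) ⊆ ℝ¹` is open. [folklore] -/
theorem isOpen_shiftedInterval : IsOpen shiftedInterval :=
  (isOpen_lt continuous_const (continuous_apply 0)).inter
    (isOpen_lt (continuous_apply 0) continuous_const)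

/-- `(1,2)` has positive Lebesgue measure (open, non-empty). [folklore] -/
theorem volume_shiftedInterval_ne_zero : volume shiftedInterval ≠ 0 :=
  isOpen_shiftedInterval.measure_ne_zero volume ⟨fun _ => 3 / 2, by norm_num [shiftedInterval]⟩

/-- `(1,2)` has finite Lebesgue measure. [folklore] -/
theorem volume_shiftedInterval_ne_top : volume shiftedInterval ≠ ⊤ :=
  (lt_of_le_of_lt (measure_mono shiftedInterval_subset_Icc)
    (isCompact_Icc.measure_lt_top)).ne

/-- The witness `[(1,2), dt/t]` against `WithoutDomain`: a weight-`1` word integrand (`ε = 0`,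
`q = 1`) on the wrong domain. [folklore] -/
def logTwoRep : KZ.IntegralRep 1 where
  domain := shiftedInterval
  integrand t := 1 / t 0
  isSemialgebraic_domain := isSemialgebraic_shiftedInterval
  isSemialgebraicFunOn_integrand := by
    refine (isSemialgebraicFunOn_aeval_div_aeval isSemialgebraic_shiftedInterval
      (1 : MvPolynomial (Fin 1) ℚ) (X 0) fun t ht => ?_).congr fun t _ => by simp
    simpa using (zero_lt_one.trans ht.1).ne'
  integrableOn := by
    have hc : ContinuousOn (fun t : Fin 1 → ℝ => 1 / t 0) (Icc (fun _ => (1 : ℝ)) (fun _ => 2)) := by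
      refine ContinuousOn.div continuousOn_const (continuous_apply 0).continuousOn fun t ht => ?_
      exact (zero_lt_one.trans_le (ht.1 0)).ne'
    exact (hc.integrableOn_compact isCompact_Icc).mono_set shiftedInterval_subset_Icc

/-- Its value is positive (`≥ ½ · vol (1,2) > 0`; in fact `log 2`). [folklore] -/
theorem logTwoRep_value_pos : 0 < logTwoRep.value := by
  have h1 : (1 / 2 : ℝ) * volume.real shiftedInterval ≤ logTwoRep.value := by
    refine setIntegral_ge_of_const_le_real isOpen_shiftedInterval.measurableSet
      volume_shiftedInterval_ne_top (fun t ht => ?_) logTwoRep.integrableOn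
    show (1 / 2 : ℝ) ≤ 1 / t 0
    exact one_div_le_one_div_of_le (zero_lt_one.trans ht.1) ht.2.le
  have h2 : 0 < volume.real shiftedInterval :=
    ENNReal.toReal_pos volume_shiftedInterval_ne_zero volume_shiftedInterval_ne_top
  linarith

/-- **Load-bearing: the domain hypothesis cannot be dropped.** Witness `[(1,2), dt/t]`
(`w = 1`, `ε = 0`, `q = 1`): the weight-`1` Hoffman closure is `⊥`, so `WithoutDomain` forces
`[(1,2), dt/t] ∈ KZ.relations`, value `0`, against `value = log 2 > 0`. [folklore] -/
theorem not_withoutDomain : ¬ WithoutDomain := by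
  intro h
  have h0 := value_eq_zero_of_weight_one logTwoRep
    (h 1 (fun _ => false) 1 logTwoRep fun t _ => by simp [logTwoRep])
  exact logTwoRep_value_pos.ne' h0

/-- `StrictAnti` is automatic in dimension `1`. [folklore] -/
theorem strictAnti_fin_one (t : Fin 1 → ℝ) : StrictAnti t := fun a b hab =>
  absurd hab (by rw [Subsingleton.elim a b]; exact lt_irrefl _)

/-- The weight-`1` simplex is the open unit interval `(0,1) ⊆ ℝ¹`. [folklore] -/
theorem simplex_one_eq : simplex 1 = {t : Fin 1 → ℝ | 0 < t 0 ∧ t 0 < 1} := by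
  ext t
  simp only [simplex, mem_setOf_eq, Fin.forall_fin_one, strictAnti_fin_one t, and_true]

/-- The weight-`1` simplex is open. [folklore] -/
theorem isOpen_simplex_one : IsOpen (simplex 1) := by
  rw [simplex_one_eq]
  exact (isOpen_lt continuous_const (continuous_apply 0)).inter
    (isOpen_lt (continuous_apply 0) continuous_const)

/-- The weight-`1` simplex lies in the compact box `[0,1]`. [folklore] -/
theorem simplex_one_subset_Icc : simplex 1 ⊆ Icc (fun _ => (0 : ℝ)) (fun _ => 1) := by
  intro t ht
  rw [simplex_one_eq] at ht
  refine ⟨fun i => ?_, fun i => ?_⟩ <;> fin_cases i <;> simp [ht.1.le, ht.2.le]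

/-- The weight-`1` simplex has positive Lebesgue measure. [folklore] -/
theorem volume_simplex_one_ne_zero : volume (simplex 1) ≠ 0 :=
  isOpen_simplex_one.measure_ne_zero volume
    ⟨fun _ => 1 / 2, by rw [simplex_one_eq]; norm_num⟩

/-- The weight-`1` simplex has finite Lebesgue measure. [folklore] -/
theorem volume_simplex_one_ne_top : volume (simplex 1) ≠ ⊤ :=
  (lt_of_le_of_lt (measure_mono simplex_one_subset_Icc) (isCompact_Icc.measure_lt_top)).ne

/-- The witness `[Δ₁, 1]` against `WithoutIntegrand`: the constant `1` on the weight-`1` simplex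
`(0,1)`. [folklore] -/
def unitRep : KZ.IntegralRep 1 where
  domain := simplex 1
  integrand _ := 1
  isSemialgebraic_domain := KZ.isSemialgebraic_openOrderedSimplex 1
  isSemialgebraicFunOn_integrand :=
    (isSemialgebraicFunOn_aeval (KZ.isSemialgebraic_openOrderedSimplex 1) 1).congr
      fun t _ => by simp
  integrableOn := by
    refine (integrableOn_const_iff).mpr (Or.inr ?_)
    exact lt_top_iff_ne_top.mpr volume_simplex_one_ne_top

/-- Its value is `vol Δ₁ > 0` (`= 1`). [folklore] -/
theorem unitRep_value_pos : 0 < unitRep.value := by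
  show 0 < ∫ _ in simplex 1, (1 : ℝ)
  rw [setIntegral_const, smul_eq_mul, mul_one]
  exact ENNReal.toReal_pos volume_simplex_one_ne_zero volume_simplex_one_ne_top

/-- **Load-bearing: the word shape of the integrand cannot be dropped.** Witness `[Δ₁, 1]`:
`WithoutIntegrand` forces it into `KZ.relations` (weight-`1` Hoffman closure `= ⊥`), value `0`,
against value `1`. [folklore] -/
theorem not_withoutIntegrand : ¬ WithoutIntegrand := by
  intro h
  exact unitRep_value_pos.ne' (value_eq_zero_of_weight_one unitRep (h 1 unitRep rfl))



/-! ## §2 A refuted strengthening: integer recombination with the SAME coefficient -/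

/-- STRENGTHENING (refuted below): the Hoffman generators must carry the same rational coefficient
`q` as the given word generator, i.e. only integer recombination is allowed. -/
def SameCoefficient : Prop :=
  ∀ (w : ℕ) (ε : Fin w → Bool) (q : ℚ) (s : KZ.IntegralRep w),
    s.domain = {t | (∀ i, 0 < t i) ∧ (∀ i, t i < 1) ∧ StrictAnti t} →
    EqOn s.integrand (fun t => (q : ℝ) * ∏ i, if ε i then 1 / (1 - t i) else 1 / t i) s.domain →
    ∃ m ∈ AddSubgroup.closure {x : KZ.FormalRep | ∃ (u : List ℕ)
        (s' : KZ.IntegralRep (MZV.weight u)), MZV.IsHoffman u ∧ MZV.weight u = w ∧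
        s'.domain = {t | (∀ i, 0 < t i) ∧ (∀ i, t i < 1) ∧ StrictAnti t} ∧
        EqOn s'.integrand (fun t => (q : ℝ) * KZ.mzvIntegrand u t) s'.domain ∧ x = KZ.of s'},
      KZ.of s - m ∈ KZ.relations

/-- Every weight-`4` Hoffman generator with coefficient `1` has value `ζ(2,2) = π⁴/120`
(`Negative.value_ω22`, off-domain freedom, soundness). [folklore] -/
theorem value_of_isHoffman_four {u : List ℕ} (hu : MZV.IsHoffman u) (hw : MZV.weight u = 4)
    (s' : KZ.IntegralRep (MZV.weight u))
    (hd : s'.domain = {t | (∀ i, 0 < t i) ∧ (∀ i, t i < 1) ∧ StrictAnti t})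
    (hi : EqOn s'.integrand (fun t => ((1 : ℚ) : ℝ) * KZ.mzvIntegrand u t) s'.domain) :
    s'.value = Real.pi ^ 4 / 120 := by
  obtain rfl := eq_two_two_of_isHoffman hu hw
  have hr : KZ.of s' - KZ.of (wordRep (w := MZV.weight [2, 2]) ω22 1 adm_ω22) ∈ KZ.relations := by
    refine of_sub_of_wordRep_mem_relations (w := MZV.weight [2, 2]) adm_ω22 s' hd fun t ht => ?_
    rw [hi ht]
    simp only [KZ.mzvIntegrand, KZ.mzvForm]
    congr 1
  have := (AddMonoidHom.mem_ker).1 (KZ.relations_le_ker_eval_holds hr)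
  rw [map_sub, sub_eq_zero, KZ.eval_of, KZ.eval_of] at this
  rw [this]
  exact value_ω22

/-- **Refuted strengthening.** `SameCoefficient` fails at weight `4`: `[Δ₄, ω₀ω₀ω₀ω₁]` has value
`ζ(4) = π⁴/90` (`Negative.value_ω4`), every element of the closure of the coefficient-`1` Hoffman
generators of weight `4` has value in `ℤ · π⁴/120`, and `π⁴/90 = n · π⁴/120` forces `3n = 4`.
So the crux genuinely needs the free rational coefficient `q'` (realised by `KZ.scale`, not by a
division rule): `ζ(4) = (4/3) ζ(2,2)`. [folklore] -/
theorem not_sameCoefficient : ¬ SameCoefficient := by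
  intro h
  obtain ⟨m, hm, hrel⟩ := h 4 ω4 1 (wordRep ω4 1 adm_ω4) rfl (fun t _ => rfl)
  have hval : ∃ n : ℤ, KZ.eval m = n * (Real.pi ^ 4 / 120) := by
    clear hrel
    induction hm using AddSubgroup.closure_induction with
    | mem x hx =>
      obtain ⟨u, s', hu, hw, hd, hi, rfl⟩ := hx
      exact ⟨1, by rw [KZ.eval_of, value_of_isHoffman_four hu hw s' hd hi]; simp⟩
    | zero => exact ⟨0, by simp⟩
    | add x y _ _ hx hy =>
      obtain ⟨a, ha⟩ := hx
      obtain ⟨b, hb⟩ := hy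
      exact ⟨a + b, by rw [map_add, ha, hb]; push_cast; ring⟩
    | neg x _ hx =>
      obtain ⟨a, ha⟩ := hx
      exact ⟨-a, by rw [map_neg, ha]; push_cast; ring⟩
  obtain ⟨n, hn⟩ := hval
  have h0 := (AddMonoidHom.mem_ker).1 (KZ.relations_le_ker_eval_holds hrel)
  rw [map_sub, sub_eq_zero, KZ.eval_of, value_ω4, hn] at h0
  have h3 : (4 : ℝ) * Real.pi ^ 4 = 3 * n * Real.pi ^ 4 := by linarith [h0]
  have hne : Real.pi ^ 4 ≠ 0 := by positivity
  have h4 : (4 : ℝ) = 3 * n := mul_right_cancel₀ hne h3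
  have h5 : (4 : ℤ) = 3 * n := by exact_mod_cast h4
  omega

end Summit.KontsevichZagierPeriods.HoffmanSpanInKZ.Negative
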